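import Literature.AlgebraicGeometry.Frobenioids.GeometricFrobenioids
import Literature.AlgebraicGeometry.Frobenioids.FinSubextCatDivSlim
import Literature.AlgebraicGeometry.Frobenioids.FinSubextCatFrobeniusSlim
import HarnessLib

/-!
# Frobenioids I, §6: Theorem 6.2 (iv) (Geometric Frobenioids: Frobenius-slim, slim, Div-slim) — PROOFS

Mochizuki, *The geometry of Frobenioids I*, Kyushu J. Math. **62** (2008), kurims text p. 111 (Thm. 6.2
(iv): "`D` is Frobenius-slim. Let `Z ⊆ G` be the subgroup of elements that commute with some open subgroup
of `G`. Then `D` is slim if and only if `Z = {1}`; `D` is Div-slim [relative to `Φ`] if and only if, for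
every `1 ≠ z ∈ Z`, there exists a finite Galois extension `L ⊆ K̃` of `K` such that `z` acts nontrivially
on `Φ(L)`"), proof p. 112. [cite: MochizukiFrdI2008, Thm. 6.2 (iv) p.111]

PROOF-ONLY companion of abc-iut-L1-t3's `GeometricFrobenioids.lean` (v2; discharge seat abc-iut-L6-t10,
D-ζ-c); no statement of that file is restated or altered. Results, for EVERY instance `M` of the interface
`GeometricModelFrobenioid Γ C`:
* `Thm62iv_iff`: the named statement `Thm62iv M` is equivalent to its third conjunct (the Div-slim criterion) —
  the first two ("`D` is Frobenius-slim"; "`D` is slim iff `Z = {1}`") are PROVED outright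
  (`FinSubextCat.isFrobeniusSlim`, `FinSubextCat.isSlim_iff`);
* `Thm62iv_of_pullInjective`: `Thm62iv M` from injectivity of divisor pull-back (`FinSubextCat.PullInjective`,
  the Div-slim criterion of `FinSubextCatDivSlim.lean`);
* `Thm62iv_holds : Thm62iv M` — UNCONDITIONAL: v2's `monEquiv_natural` makes pull-back injective
  (t3's `GeometricModelFrobenioid.pull_injective`).
The constructed model `geomModelFrobenioid Γ` and Thm. 6.2 (ii)/(iii) for it are in `GeometricFrobenioidModel.lean`.
-/

noncomputable section

namespace Literature.AlgebraicGeometry.Frobenioids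

open CategoryTheory

universe u v

section Thm62

variable {K : Type} [Field K] {Kt : Type} [Field Kt] [Algebra K Kt] [IsGalois K Kt]
variable {Γ : GeometricDivisorData K Kt} {C : Type u} [Category.{v} C] (M : GeometricModelFrobenioid Γ C)

/-- **Theorem 6.2 (iv)** — first two assertions PROVED: the named statement `Thm62iv M` holds iff its third
conjunct (the Div-slim criterion for `M.ops`) does. [cite: MochizukiFrdI2008, Thm. 6.2 (iv) p.111] -/
theorem Thm62iv_iff :
    Thm62iv M ↔ (M.ops.IsDivSlim ↔ FinSubextCat.MovesSomeGalois M.ops) :=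
  ⟨fun h => h.2.2, fun h => ⟨FinSubextCat.isFrobeniusSlim K Kt, FinSubextCat.isSlim_iff K Kt, h⟩⟩

/-- **Theorem 6.2 (iv)** from injectivity of divisor pull-back along the morphisms of `D`
(`FinSubextCat.PullInjective`): Frobenius-slim; slim iff `Z = {1}`; Div-slim iff every `1 ≠ z ∈ Z` acts
nontrivially on `Φ(L)` for some finite Galois `L`. [cite: MochizukiFrdI2008, Thm. 6.2 (iv) p.111] -/
theorem Thm62iv_of_pullInjective (hinj : FinSubextCat.PullInjective M.ops) : Thm62iv M :=
  (Thm62iv_iff M).mpr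
    ⟨fun h => FinSubextCat.movesGalois_of_aut_eq_one hinj h.eq_one,
      fun h => ⟨FinSubextCat.aut_eq_one_of_movesGalois hinj h⟩⟩

/-- **Theorem 6.2 (iv) — PROVED** for every instance of the interface: "`D` is Frobenius-slim; `D` is slim iff
`Z = {1}`; `D` is Div-slim iff for every `1 ≠ z ∈ Z` there is a finite Galois `L ⊆ K̃` over `K` such that `z` acts
nontrivially on `Φ(L)`" (FrdI p. 111; pull-back injectivity from abc-iut-L1-t3's
`GeometricModelFrobenioid.pull_injective`). [cite: MochizukiFrdI2008, Thm. 6.2 (iv) p.111] -/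
theorem Thm62iv_holds : Thm62iv M :=
  Thm62iv_of_pullInjective M fun _ _ σ => M.pull_injective σ

end Thm62

end Literature.AlgebraicGeometry.Frobenioids

end
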